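import Summits.QuantumFields.YangMills.Theorems.BalabanLadderNTAFCollarLaw
import Summits.QuantumFields.YangMills.Theorems.BalabanLadderNTCornerPriceThreePoint
import HarnessLib

/-!
# Crux `NT` (stmt-QuantumFields-19353), stub `stub_refpkgT : RefPkgT`: the asymptotic-freedom collar law WITH THE CORNER PRICE —
# `2D²(2δ/κ)⁸ < W`, `2D³(δ'/κ)¹² < W₃`, `D = 6(N − Re tr ρ(g))`

Helper file (`--supports stmt-QuantumFields-19353`) of the fleet lead prover of crux `NT` (unit `ym-spine-19353-p1`, GEN 13);
composition of `…NTAFCollarLaw` (pointwise tolerance + registered clause 4/5 ⇒ `2C₁²(2δ)⁸ < Wκ⁸`, `2C₁³δ'¹² < W₃κ¹²`) with the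
corner price of `…NTCornerPrice[ThreePoint]` (clause 1 on the unit cube ⇒ `C₁ ≥ D`; corner floors of the margins):

* **`two_mul_sq_lt_tolerance_of_clause4_at_corner`** — `2D²(2δ)⁸ < W·κ⁸` for every `g ∈ G`;
* **`two_mul_cube_lt_tolerance₃_of_clause5_at_corner`** — `2D³δ'¹² < W₃·κ¹²` for every `g ∈ G`.

NUMBERS (memo SIZING-19353-g13 §2): `SU(2)` fundamental (`D = 24`): `δ/κ < ½(W/1152)^{1/8} = 0.207·W^{1/8}`;
`δ'/κ < (W₃/27648)^{1/12}`.

HONEST FRAMING.  One-line compositions; CONDITIONAL on clause 1 at the coupling, the registered clause 4/5 inequality and the pointwise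
tolerance; no floor, not AF, not NT, not the seam, not the gap; not Clay.
-/

set_option autoImplicit false

noncomputable section

open scoped SchwartzMap
open MeasureTheory Filter Topology
open Literature.MathematicalPhysics.QuantumFieldTheory Literature.MathematicalPhysics.QuantumLattice
open Literature.Probability.LatticeModels
open Summit.QuantumFields.YangMills.Cruxes.OSLegsFromFemtoAndGap.DlrCollarTransfer

namespace Summit.QuantumFields.YangMills.Cruxes.NT.CornerPrice

section Laws

variable (G : Type) [Group G] [TopologicalSpace G] [IsTopologicalGroup G] [CompactSpace G]
  [MeasurableSpace G] [BorelSpace G] (r : LatticeRep G)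

/-- **The AF collar law with the corner price: `2D²(2δ)⁸ < W·κ⁸`**, `D = 6(N − Re tr ρ(g))` for every `g ∈ G`: clause 1 at the
coupling (spacing `0 < s ≤ ℓ`), the registered clause-4 inequality on a torus (`ε > 0`, `C₂ ≥ 0`, `κ > 0`, witness time gap `δ > 0`)
and the pointwise tolerance `‖y−x‖⁸·|Cov_T(A_x,A_y)| ≤ W` on the charged pairs. [folklore] -/
theorem two_mul_sq_lt_tolerance_of_clause4_at_corner (β : ℝ) {C₁ C₂ ℓ s κ W : ℝ} (hC₂ : 0 ≤ C₂) (hκ : 0 < κ)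
    (hs : 0 < s) (hsℓ : s ≤ ℓ)
    (hE1 : ∀ (c : Fin 4 → ℤ) (b : ℕ), (b : ℝ) * s ≤ ℓ → ∀ (η η' : LGConfig 4 G) (x : Fin 4 → ℤ),
      1 ≤ depth c b x → |kerE G r β c b η (dens G r x) - kerE G r β c b η' (dens G r x)| ≤ C₁ / (depth c b x : ℝ) ^ 4)
    {v : 𝓢(EuclideanSpace ℝ (Fin 4), ℝ)} {δ ε : ℝ} (hε : 0 < ε) (hδ : 0 < δ)
    (hvδ : ∀ y : EuclideanSpace ℝ (Fin 4), v y ≠ 0 → δ ≤ y 0) {L : ℕ}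
    (hW : ∀ x ∈ box 4 L, ∀ y ∈ box 4 L, thetaTest 4 v (s • siteToE x) ≠ 0 → v (s • siteToE y) ≠ 0 →
      ‖siteToE (y - x)‖ ^ 8 * |torusE G r β L (fun U => dens G r x U * dens G r y U) -
        torusE G r β L (dens G r x) * torusE G r β L (dens G r y)| ≤ W)
    (hfloor : ε + 2 * (C₁ * (s / κ) ^ 4 * ∑ x ∈ box 4 L, |thetaTest 4 v (s • siteToE x)|) *
          (C₁ * (s / κ) ^ 4 * ∑ y ∈ box 4 L, |v (s • siteToE y)|) +
        C₂ * (s / κ) ^ 4 * ∑ x ∈ box 4 L, ∑ y ∈ box 4 L,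
          |thetaTest 4 v (s • siteToE x)| * |v (s • siteToE y)| / (1 + ‖siteToE (y - x)‖) ^ 4 ≤
      Q2 G r β L s (thetaTest 4 v) v)
    (g₀ : G) : 2 * (6 * ((r.N : ℝ) - (r.ρ g₀).trace.re)) ^ 2 * (2 * δ) ^ 8 < W * κ ^ 8 := by
  have hcorner := q2_ge_cornerMargin_of_clause4_at G r β hC₂ hsℓ hE1 hfloor g₀
  have hcap := AFCollar.abs_Q2_le_of_tolerance G r β hs hδ hvδ hW
  have hkey := AFCollar.two_mul_sq_lt_of_window (C₁ := 6 * ((r.N : ℝ) - (r.ρ g₀).trace.re)) (t := (s / κ) ^ 4) hε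
    (Finset.sum_nonneg fun _ _ => abs_nonneg _) (Finset.sum_nonneg fun _ _ => abs_nonneg _) hcorner
    ((le_abs_self _).trans hcap)
  exact AFCollar.law₂_of_scaled hs hκ hδ hkey

/-- **The three-point AF collar law with the corner price: `2D³δ'¹² < W₃·κ¹²`**, `D = 6(N − Re tr ρ(g))` for every `g ∈ G`:
clause 1 at the coupling (spacing `0 < s ≤ ℓ`), the registered clause-5 inequality on a torus (`ε > 0`, `C₂, C₃ ≥ 0`, `κ > 0`,
pairwise support separation `δ' > 0`) and the pointwise three-point tolerance `m¹²·|κ₃,T| ≤ W₃` on the charged triples. [folklore] -/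
theorem two_mul_cube_lt_tolerance₃_of_clause5_at_corner (β : ℝ) {C₁ C₂ C₃ ℓ s κ W₃ : ℝ} (hC₂ : 0 ≤ C₂) (hC₃ : 0 ≤ C₃)
    (hκ : 0 < κ) (hs : 0 < s) (hsℓ : s ≤ ℓ)
    (hE1 : ∀ (c : Fin 4 → ℤ) (b : ℕ), (b : ℝ) * s ≤ ℓ → ∀ (η η' : LGConfig 4 G) (x : Fin 4 → ℤ),
      1 ≤ depth c b x → |kerE G r β c b η (dens G r x) - kerE G r β c b η' (dens G r x)| ≤ C₁ / (depth c b x : ℝ) ^ 4)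
    {f g h : 𝓢(EuclideanSpace ℝ (Fin 4), ℝ)} {δ' ε : ℝ} (hε : 0 < ε) (hδ' : 0 < δ')
    (hfg : ∀ p q : EuclideanSpace ℝ (Fin 4), f p ≠ 0 → g q ≠ 0 → δ' ≤ ‖p - q‖)
    (hgh : ∀ p q : EuclideanSpace ℝ (Fin 4), g p ≠ 0 → h q ≠ 0 → δ' ≤ ‖p - q‖)
    (hfh : ∀ p q : EuclideanSpace ℝ (Fin 4), f p ≠ 0 → h q ≠ 0 → δ' ≤ ‖p - q‖) {L : ℕ}
    (hW : ∀ x ∈ box 4 L, ∀ y ∈ box 4 L, ∀ z ∈ box 4 L, f (s • siteToE x) ≠ 0 → g (s • siteToE y) ≠ 0 →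
      h (s • siteToE z) ≠ 0 →
        (min (min ‖siteToE (y - x)‖ ‖siteToE (z - y)‖) ‖siteToE (z - x)‖) ^ 12 * |torusK3 G r β L x y z| ≤ W₃)
    (hfloor : ε + ∑ x ∈ box 4 L, ∑ y ∈ box 4 L, ∑ z ∈ box 4 L,
        |f (s • siteToE x)| * |g (s • siteToE y)| * |h (s • siteToE z)| *
          (2 * ((C₁ * (s / κ) ^ 4) * (C₂ * (s / κ) ^ 4 / (1 + ‖siteToE (z - y)‖) ^ 4) +
                (C₁ * (s / κ) ^ 4) * (C₂ * (s / κ) ^ 4 / (1 + ‖siteToE (z - x)‖) ^ 4) +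
                (C₁ * (s / κ) ^ 4) * (C₂ * (s / κ) ^ 4 / (1 + ‖siteToE (y - x)‖) ^ 4) +
                (C₁ * (s / κ) ^ 4) * (C₁ * (s / κ) ^ 4) * (C₁ * (s / κ) ^ 4)) +
            C₃ * (s / κ) ^ 4 / (1 + min (min ‖siteToE (y - x)‖ ‖siteToE (z - y)‖) ‖siteToE (z - x)‖) ^ 8) ≤
      |Q3 G r β L s f g h|)
    (g₀ : G) : 2 * (6 * ((r.N : ℝ) - (r.ρ g₀).trace.re)) ^ 3 * δ' ^ 12 < W₃ * κ ^ 12 := by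
  have hcorner := q3_ge_cornerMargin_of_clause5_at G r β hC₂ hC₃ hsℓ hE1 hfloor g₀
  have hcap := AFCollar.abs_Q3_le_of_tolerance₃ G r β hs hδ' hfg hgh hfh hW
  have hP0 : 0 ≤ (∑ x ∈ box 4 L, |f (s • siteToE x)|) * (∑ y ∈ box 4 L, |g (s • siteToE y)|) *
      (∑ z ∈ box 4 L, |h (s • siteToE z)|) := mul_nonneg (mul_nonneg (Finset.sum_nonneg fun _ _ => abs_nonneg _)
    (Finset.sum_nonneg fun _ _ => abs_nonneg _)) (Finset.sum_nonneg fun _ _ => abs_nonneg _)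
  exact AFCollar.law₃_of_scaled hs hκ hδ'
    (AFCollar.two_mul_cube_lt_of_window (C₁ := 6 * ((r.N : ℝ) - (r.ρ g₀).trace.re)) (t := (s / κ) ^ 4) hε hP0 hcorner hcap)

end Laws

end Summit.QuantumFields.YangMills.Cruxes.NT.CornerPrice

end
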